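import Literature.Probability.LatticeModels.ClusteringToTreeBound
import Literature.Probability.LatticeModels.WeightedTreeBoundCorrelations
import Literature.Probability.LatticeModels.UrsellFourCurrentsProofs
import Literature.Probability.LatticeModels.WeightedCurrentsDictionary
import Literature.Probability.LatticeModels.IsingTransport
import Literature.Probability.LatticeModels.SharpnessSubcritical
import HarnessLib

/-!
# From the clustering reduction to correlation functions (Aizenman–Duminil-Copin 2021, §4.1/§6.1, display (4.6)/"(eq:p1)")

Topic `Literature/Probability/LatticeModels`; family `crit-ising` (crit-ising.S13). Theorems only: no
definition and no named fact is introduced.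

`ClusteringToTreeBound` proves the §4.1 reduction of M. Aizenman, H. Duminil-Copin, *Marginal
triviality of the scaling limits of critical 4D Ising and `φ⁴₄` models*, Ann. of Math. **194** (2021) =
arXiv:1912.07973, in un-normalised current-sum form on a finite graph
(`Current.ursellInter_mul_sq_le`: `Z[∅]² · P ≤ ∑_u clusteringMass u + treeMass / 2^r`, `P` the
intersection sum with `U₄ · Z[∅]² = -2P`). This file normalises it, i.e. it proves the sentence "Adding
(4.6) … gives an improved tree diagram bound" of §4.1 (p. 11; §6.1, p. 21: "so that (eq:p1) implies the
improved tree diagram bound inequality") at the level of correlation functions, with the clustering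
probabilities kept as an abstract weight `p_u`:

* `abs_ursell_ratio_le_of_clusteringMass_le` — for couplings `K ≥ 0` on a finite graph and the ratios
  `⟨σ_A⟩ = Z_K[A]/Z_K[∅]`: if `clusteringMass u ≤ p_u · Z[yu]Z[xu]Z[tu]Z[zu]` for every `u` (i.e. the
  normalised probability `P^{uy,ux} ⊗ P^{ut,uz}[M_u(C(u) ∩ C'(u); ℓ, K_s) < 7r]` is at most `p_u`), then
  `|U₄(x,y,z,t)| ≤ 2 ∑_u ⟨σ_xσ_u⟩⟨σ_yσ_u⟩⟨σ_zσ_u⟩⟨σ_tσ_u⟩ (p_u + 2^{-r})` — ADC's display with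
  `2^{-δK}` and `2^{-δK/5}` replaced by `p_u` and `2^{-r}` (the conversion `ℝ≥0∞ → ℝ` follows
  `abs_ursell_ratio_le` of `WeightedTreeBoundCorrelations`);
* `abs_connectedFour_isingMeasure_le_of_clusteringMass_le` — the same for the free Ising state with
  uniform coupling `β ≥ 0` on a finite graph (`connectedFour`, `isingTwoPoint`; dictionary
  `isingExpect_spinMonomial_four_eq`, `isingTwoPoint_free_eq_currentSum_div_holds`);
* `abs_connectedFour_free_finset_le_of_clusteringMass_le` — the same for the free state of a finite
  `Λ ⊆ ℤ^d` (the Ising model of the induced graph on `↥Λ`, `isingExpect_free_map`), the annuli being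
  those of the sup-metric of `ℤ^d` restricted to `↥Λ`;
* `abs_connectedFour_free_box_le_of_bulk_clustering` — for `Λ = Λ_N` and weights `p_u ≤ 1` that are
  `≤ a` in the bulk `Λ_{N-R}`:
  `|U₄^{Λ_N}(x)| ≤ 2(a + 2^{-r}) ∑_{u ∈ Λ_N} ∏ⱼ⟨σ_uσ_{xⱼ}⟩_{Λ_N} + 4 ∑_{u ∈ Λ_N, ‖u‖_∞ > N-R} ∏ⱼ⟨σ_uσ_{xⱼ}⟩_{Λ_N}`,
  which is the hypothesis shape of the thermodynamic-limit transfer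
  `abs_connectedFour_le_of_finiteVolume_free` / `aizenmanDuminilCopin_improvedTreeDiagramBound_of_finiteVolume`
  (`ImprovedTreeDiagramBoundTransfer`). What then remains of Theorem 1.3 is the intersection-clustering
  bound proper (ADC Prop. 6.1) for the bulk vertices of large boxes, and the choice of scales.

## References

* M. Aizenman, H. Duminil-Copin, Ann. of Math. 194 (2021), arXiv:1912.07973, §4.1 (proof of Thm 1.3,
  displays (4.5)–(4.6) and "Adding … gives an improved tree diagram bound"), §6.1 (p. 21)
  [AizenmanDuminilCopinAnnals2021].

## Mathlib

`ENNReal.toReal` algebra (`toReal_add/mul/sum/div/pow/ofReal`), `Finset.sum_filter_add_sum_filter_not`,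
`SimpleGraph.comap`, `Function.Embedding.subtype`.
-/

noncomputable section

open Finset Filter
open scoped symmDiff ENNReal

namespace Literature.Probability.LatticeModels

variable {V : Type*} [Fintype V] [DecidableEq V]

/-! ### Part 1. The ratios `Z_K[A]/Z_K[∅]` -/

section Ratios

variable {G : SimpleGraph V} [DecidableRel G.Adj] {K : G.edgeFinset → ℝ}

/-- **The improved tree diagram bound modulo clustering, for random-current ratios** (Aizenman–Duminil-Copin
2021, §4.1, "Adding (4.6) … gives an improved tree diagram bound"): for `K ≥ 0` on a finite graph with
a pseudo-metric on its vertices, a scale sequence `1 ≤ ℓ₁`, `2ℓ_k ≤ ℓ_{k+1}`, and `⟨σ_A⟩ := Z_K[A]/Z_K[∅]`: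
if the clustering masses satisfy `clusteringMass u ≤ p_u · Z[yu]Z[xu]Z[tu]Z[zu]` (`p_u ≥ 0`), then
`|⟨σ_xσ_yσ_zσ_t⟩ - ⟨σ_xσ_y⟩⟨σ_zσ_t⟩ - ⟨σ_xσ_z⟩⟨σ_yσ_t⟩ - ⟨σ_xσ_t⟩⟨σ_yσ_z⟩| ≤
  2 ∑_u ⟨σ_xσ_u⟩⟨σ_yσ_u⟩⟨σ_zσ_u⟩⟨σ_tσ_u⟩ (p_u + 2^{-r})`.
[cite: AizenmanDuminilCopinAnnals2021, arXiv:1912.07973 §4.1, proof of Thm 1.3, displays (4.5)–(4.6) (p. 11) and §6.1 (p. 21)] -/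
theorem abs_ursell_ratio_le_of_clusteringMass_le [PseudoMetricSpace V] (hK : ∀ e, 0 ≤ K e)
    {ℓ : ℕ → ℕ} (h1 : 1 ≤ ℓ 1) (h2 : ∀ k, 2 * ℓ k ≤ ℓ (k + 1)) (Ks r : ℕ) (x y z t : V)
    {p : V → ℝ} (hp0 : ∀ u, 0 ≤ p u)
    (hp : ∀ u, Current.clusteringMass K ℓ Ks r x y z t u ≤
      ENNReal.ofReal (p u) * (ecurrentSum K ({y} ∆ {u}) * ecurrentSum K ({x} ∆ {u}) *
        (ecurrentSum K ({t} ∆ {u}) * ecurrentSum K ({z} ∆ {u})))) :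
    |wcurrentSum K ({x} ∆ ({y} ∆ ({z} ∆ {t}))) / wcurrentSum K ∅ -
        wcurrentSum K ({x} ∆ {y}) / wcurrentSum K ∅ * (wcurrentSum K ({z} ∆ {t}) / wcurrentSum K ∅) -
        wcurrentSum K ({x} ∆ {z}) / wcurrentSum K ∅ * (wcurrentSum K ({y} ∆ {t}) / wcurrentSum K ∅) -
        wcurrentSum K ({x} ∆ {t}) / wcurrentSum K ∅ * (wcurrentSum K ({y} ∆ {z}) / wcurrentSum K ∅)| ≤
      2 * ∑ u, wcurrentSum K ({x} ∆ {u}) / wcurrentSum K ∅ * (wcurrentSum K ({y} ∆ {u}) / wcurrentSum K ∅) *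
        (wcurrentSum K ({z} ∆ {u}) / wcurrentSum K ∅) * (wcurrentSum K ({t} ∆ {u}) / wcurrentSum K ∅) *
        (p u + 1 / 2 ^ r) := by
  set W : Finset V → ℝ := fun A => wcurrentSum K A with hW
  have hW' : ∀ A, (ecurrentSum K A).toReal = W A := fun A => toReal_ecurrentSum hK A
  have hW0 : 0 < W ∅ := wcurrentSum_empty_pos hK
  have hWnn : ∀ A, 0 ≤ W A := fun A => wcurrentSum_nonneg hK A
  have hZtop : ∀ A, ecurrentSum K A ≠ ∞ := fun A => ecurrentSum_ne_top hK A
  -- the intersection term `P` and its finiteness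
  set Pe : ℝ≥0∞ := ∑' q : Current G × Current G,
    epairWeight K ({x} ∆ {y}) ({z} ∆ {t}) q * (if z ∈ (q.1 + q.2).cluster x then 1 else 0) with hPe
  have hPle : Pe ≤ ecurrentSum K ({x} ∆ {y}) * ecurrentSum K ({z} ∆ {t}) := by
    rw [← tsum_epairWeight]
    refine ENNReal.tsum_le_tsum fun q => ?_
    calc epairWeight K ({x} ∆ {y}) ({z} ∆ {t}) q * (if z ∈ (q.1 + q.2).cluster x then 1 else 0)
        ≤ epairWeight K ({x} ∆ {y}) ({z} ∆ {t}) q * 1 := mul_le_mul' le_rfl (by split_ifs <;> simp)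
      _ = _ := mul_one _
  have hPtop : Pe ≠ ∞ := ne_top_of_le_ne_top (ENNReal.mul_ne_top (hZtop _) (hZtop _)) hPle
  set pr : ℝ := Pe.toReal with hpr
  have hpr0 : 0 ≤ pr := ENNReal.toReal_nonneg
  -- the identity in `ℝ`
  have hid := congrArg ENNReal.toReal (Current.ursellFour_currentSum_identity hK x y z t)
  rw [ENNReal.toReal_add (ENNReal.add_ne_top.2 ⟨ENNReal.mul_ne_top (hZtop _) (hZtop _),
      ENNReal.mul_ne_top (hZtop _) (hZtop _)⟩) (ENNReal.mul_ne_top (hZtop _) (hZtop _)),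
    ENNReal.toReal_add (ENNReal.mul_ne_top (hZtop _) (hZtop _)) (ENNReal.mul_ne_top (hZtop _) (hZtop _)),
    ENNReal.toReal_add (ENNReal.mul_ne_top (hZtop _) (hZtop _)) (ENNReal.mul_ne_top (by simp) hPtop)] at hid
  simp only [ENNReal.toReal_mul, ENNReal.toReal_ofNat, hW'] at hid
  -- the clustering reduction in `ℝ≥0∞`, with the clustering masses bounded by `p_u`
  set ZZ : V → ℝ≥0∞ := fun u => ecurrentSum K ({y} ∆ {u}) * ecurrentSum K ({x} ∆ {u}) *
    (ecurrentSum K ({t} ∆ {u}) * ecurrentSum K ({z} ∆ {u})) with hZZ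
  have hZZtop : ∀ u, ZZ u ≠ ∞ := fun u =>
    ENNReal.mul_ne_top (ENNReal.mul_ne_top (hZtop _) (hZtop _)) (ENNReal.mul_ne_top (hZtop _) (hZtop _))
  have htwo : (2 : ℝ≥0∞) ^ r ≠ 0 := pow_ne_zero _ two_ne_zero
  have htwo' : (2 : ℝ≥0∞) ^ r ≠ ∞ := ENNReal.pow_ne_top ENNReal.ofNat_ne_top
  have hmain : Pe * ecurrentSum K ∅ ^ 2 ≤ ∑ u, (ENNReal.ofReal (p u) + 1 / 2 ^ r) * ZZ u := by
    have h := Current.ursellInter_mul_sq_le hK h1 h2 Ks r x y z t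
    refine h.trans ?_
    have htree : Current.treeMass K x y z t / 2 ^ r = ∑ u, (1 / 2 ^ r) * ZZ u := by
      rw [Current.treeMass, ENNReal.div_eq_inv_mul, Finset.mul_sum]
      refine Finset.sum_congr rfl fun u _ => ?_
      rw [one_div]
    rw [htree, ← Finset.sum_add_distrib]
    refine Finset.sum_le_sum fun u _ => ?_
    rw [add_mul]
    exact add_le_add (hp u) le_rfl
  -- … and in `ℝ`
  have hbd : pr * W ∅ ^ 2 ≤ ∑ u, (p u + 1 / 2 ^ r) * (W ({y} ∆ {u}) * W ({x} ∆ {u}) *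
      (W ({t} ∆ {u}) * W ({z} ∆ {u}))) := by
    have h := ENNReal.toReal_mono (by
      refine ENNReal.sum_ne_top.2 fun u _ => ENNReal.mul_ne_top ?_ (hZZtop u)
      exact ENNReal.add_ne_top.2 ⟨ENNReal.ofReal_ne_top, ENNReal.div_ne_top ENNReal.one_ne_top htwo⟩) hmain
    rw [ENNReal.toReal_mul, ENNReal.toReal_pow, hW', ENNReal.toReal_sum (fun u _ =>
      ENNReal.mul_ne_top (ENNReal.add_ne_top.2 ⟨ENNReal.ofReal_ne_top,
        ENNReal.div_ne_top ENNReal.one_ne_top htwo⟩) (hZZtop u))] at h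
    refine h.trans (le_of_eq (Finset.sum_congr rfl fun u _ => ?_))
    rw [ENNReal.toReal_mul, ENNReal.toReal_add ENNReal.ofReal_ne_top
      (ENNReal.div_ne_top ENNReal.one_ne_top htwo), ENNReal.toReal_ofReal (hp0 u),
      ENNReal.toReal_div, ENNReal.toReal_one, ENNReal.toReal_pow, ENNReal.toReal_ofNat, hZZ]
    simp only [ENNReal.toReal_mul, hW']
  -- `hid : Wxy Wzt + Wxz Wyt + Wxt Wyz = WD W∅ + 2 pr`
  change |W _ / W ∅ - W _ / W ∅ * (W _ / W ∅) - W _ / W ∅ * (W _ / W ∅) - W _ / W ∅ * (W _ / W ∅)| ≤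
    2 * ∑ u, W _ / W ∅ * (W _ / W ∅) * (W _ / W ∅) * (W _ / W ∅) * (p u + 1 / 2 ^ r)
  have hL : W ({x} ∆ ({y} ∆ ({z} ∆ {t}))) / W ∅ - W ({x} ∆ {y}) / W ∅ * (W ({z} ∆ {t}) / W ∅) -
      W ({x} ∆ {z}) / W ∅ * (W ({y} ∆ {t}) / W ∅) - W ({x} ∆ {t}) / W ∅ * (W ({y} ∆ {z}) / W ∅) =
      -(2 * (pr * W ∅ ^ 2) / W ∅ ^ 4) := by
    field_simp
    rw [← hpr] at hid
    nlinarith [hid]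
  have hR : ∑ u, W ({x} ∆ {u}) / W ∅ * (W ({y} ∆ {u}) / W ∅) * (W ({z} ∆ {u}) / W ∅) *
      (W ({t} ∆ {u}) / W ∅) * (p u + 1 / 2 ^ r) =
      (∑ u, (p u + 1 / 2 ^ r) * (W ({y} ∆ {u}) * W ({x} ∆ {u}) *
        (W ({t} ∆ {u}) * W ({z} ∆ {u})))) / W ∅ ^ 4 := by
    rw [Finset.sum_div]
    refine Finset.sum_congr rfl fun u _ => ?_
    field_simp
  rw [hL, hR, abs_neg, abs_of_nonneg (by positivity), mul_div_assoc]
  exact mul_le_mul_of_nonneg_left (div_le_div_of_nonneg_right hbd (by positivity)) (by norm_num)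

end Ratios

/-! ### Part 2. The free Ising state on a finite graph -/

section Graph

variable {G : SimpleGraph V} [DecidableRel G.Adj]

/-- **The improved tree diagram bound modulo clustering, free Ising state of a finite graph** (uniform
coupling `β ≥ 0`, zero field): with the clustering masses of `ClusteringToTreeBound` for the constant
edge weight `K ≡ β` bounded by `p_u · Z[x₁u]Z[x₀u]Z[x₃u]Z[x₂u]`,
`|U₄(x₀,x₁,x₂,x₃)| ≤ 2 ∑_u (∏ⱼ ⟨σ_uσ_{xⱼ}⟩) (p_u + 2^{-r})` (Aizenman–Duminil-Copin 2021, §4.1,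
display (4.6) summed with (4.5)). [cite: AizenmanDuminilCopinAnnals2021, arXiv:1912.07973 §4.1, proof of Thm 1.3 (p. 11) and §6.1 (p. 21)] -/
theorem abs_connectedFour_isingMeasure_le_of_clusteringMass_le [PseudoMetricSpace V] {β : ℝ}
    (hβ : 0 ≤ β) {ℓ : ℕ → ℕ} (h1 : 1 ≤ ℓ 1) (h2 : ∀ k, 2 * ℓ k ≤ ℓ (k + 1)) (Ks r : ℕ)
    (x : Fin 4 → V) {p : V → ℝ} (hp0 : ∀ u, 0 ≤ p u)
    (hp : ∀ u, Current.clusteringMass (fun _ : G.edgeFinset => β) ℓ Ks r (x 0) (x 1) (x 2) (x 3) u ≤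
      ENNReal.ofReal (p u) *
        (ecurrentSum (fun _ : G.edgeFinset => β) ({x 1} ∆ {u}) *
          ecurrentSum (fun _ : G.edgeFinset => β) ({x 0} ∆ {u}) *
          (ecurrentSum (fun _ : G.edgeFinset => β) ({x 3} ∆ {u}) *
            ecurrentSum (fun _ : G.edgeFinset => β) ({x 2} ∆ {u})))) :
    |connectedFour (isingMeasure G univ β 0 .free) spinAt x| ≤
      2 * ∑ u, (∏ j, isingTwoPoint G univ β 0 .free u (x j)) * (p u + 1 / 2 ^ r) := by
  have hK : ∀ e : G.edgeFinset, 0 ≤ (fun _ : G.edgeFinset => β) e := fun _ => hβ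
  have h := abs_ursell_ratio_le_of_clusteringMass_le (G := G) (K := fun _ : G.edgeFinset => β) hK h1 h2
    Ks r (x 0) (x 1) (x 2) (x 3) hp0 hp
  -- the four-point function
  have hmono : spinMonomial x = spinMonomial ![x 0, x 1, x 2, x 3] := by
    funext σ
    simp [spinMonomial, Fin.prod_univ_four]
  have h4 : nPoint (isingMeasure G univ β 0 .free) spinAt x =
      wcurrentSum (fun _ : G.edgeFinset => β) ({x 0} ∆ ({x 1} ∆ ({x 2} ∆ {x 3}))) /
        wcurrentSum (fun _ : G.edgeFinset => β) ∅ := by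
    rw [nPoint_isingMeasure, hmono, isingExpect_spinMonomial_four_eq, currentSum_eq_wcurrentSum,
      currentSum_eq_wcurrentSum]
  -- the two-point functions
  have h2p : ∀ a b : V, isingTwoPoint G univ β 0 .free a b =
      wcurrentSum (fun _ : G.edgeFinset => β) ({a} ∆ {b}) / wcurrentSum (fun _ : G.edgeFinset => β) ∅ := by
    intro a b
    rw [isingTwoPoint_free_eq_currentSum_div_holds, currentSum_eq_wcurrentSum, currentSum_eq_wcurrentSum]
  have h2' : ∀ a b : V, twoPoint (isingMeasure G univ β 0 .free) spinAt a b =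
      wcurrentSum (fun _ : G.edgeFinset => β) ({a} ∆ {b}) / wcurrentSum (fun _ : G.edgeFinset => β) ∅ := by
    intro a b
    rw [twoPoint_isingMeasure, h2p]
  rw [connectedFour, h4, h2', h2', h2', h2', h2', h2']
  refine h.trans (le_of_eq ?_)
  congr 1
  refine Finset.sum_congr rfl fun u _ => ?_
  rw [Fin.prod_univ_four, h2p, h2p, h2p, h2p, symmDiff_comm ({u} : Finset V) {x 0},
    symmDiff_comm ({u} : Finset V) {x 1}, symmDiff_comm ({u} : Finset V) {x 2},
    symmDiff_comm ({u} : Finset V) {x 3}]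

end Graph

/-! ### Part 3. The free state of a finite volume of `ℤ^d` -/

section Lattice

variable {d : ℕ}

/-- **The improved tree diagram bound modulo clustering, free state of a finite `Λ ⊆ ℤ^d`**: the free
finite-volume state of `Λ` is the Ising model of the induced graph on `↥Λ` (`isingExpect_free_map`),
whose vertices carry the sup-metric of `ℤ^d`; with the clustering masses of that graph (coupling
`K ≡ β ≥ 0`) bounded by `p_u · Z[x₁u]Z[x₀u]Z[x₃u]Z[x₂u]` for `u ∈ Λ`,
`|U₄^{Λ}(x)| ≤ 2 ∑_{u ∈ Λ} (∏ⱼ ⟨σ_uσ_{xⱼ}⟩_Λ) (p_u + 2^{-r})`. [cite: AizenmanDuminilCopinAnnals2021, arXiv:1912.07973 §4.1, proof of Thm 1.3 (p. 11) and §6.1 (p. 21)] -/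
theorem abs_connectedFour_free_finset_le_of_clusteringMass_le {β : ℝ} (hβ : 0 ≤ β)
    (Λ : Finset (Site d)) {ℓ : ℕ → ℕ} (h1 : 1 ≤ ℓ 1) (h2 : ∀ k, 2 * ℓ k ≤ ℓ (k + 1)) (Ks r : ℕ)
    (x : Fin 4 → Site d) (hx : ∀ i, x i ∈ Λ) {p : Site d → ℝ} (hp0 : ∀ u, 0 ≤ p u)
    (hp : ∀ u : ↥Λ,
      Current.clusteringMass (G := (zdGraph d).comap (Function.Embedding.subtype fun v => v ∈ Λ))
          (fun _ => β) ℓ Ks r ⟨x 0, hx 0⟩ ⟨x 1, hx 1⟩ ⟨x 2, hx 2⟩ ⟨x 3, hx 3⟩ u ≤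
        ENNReal.ofReal (p u) *
          (ecurrentSum (G := (zdGraph d).comap (Function.Embedding.subtype fun v => v ∈ Λ))
              (fun _ => β) ({⟨x 1, hx 1⟩} ∆ {u}) *
            ecurrentSum (G := (zdGraph d).comap (Function.Embedding.subtype fun v => v ∈ Λ))
              (fun _ => β) ({⟨x 0, hx 0⟩} ∆ {u}) *
            (ecurrentSum (G := (zdGraph d).comap (Function.Embedding.subtype fun v => v ∈ Λ))
                (fun _ => β) ({⟨x 3, hx 3⟩} ∆ {u}) *
              ecurrentSum (G := (zdGraph d).comap (Function.Embedding.subtype fun v => v ∈ Λ))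
                (fun _ => β) ({⟨x 2, hx 2⟩} ∆ {u})))) :
    |connectedFour (isingMeasure (zdGraph d) Λ β 0 .free) spinAt x| ≤
      2 * ∑ u ∈ Λ, (∏ j, isingTwoPoint (zdGraph d) Λ β 0 .free u (x j)) * (p u + 1 / 2 ^ r) := by
  set φ : ↥Λ ↪ Site d := Function.Embedding.subtype fun v => v ∈ Λ with hφ
  have hmapΛ : (Finset.univ : Finset ↥Λ).map φ = Λ := by
    rw [Finset.univ_eq_attach, hφ, Finset.attach_map_val]
  set y : Fin 4 → ↥Λ := fun i => ⟨x i, hx i⟩ with hy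
  have key := abs_connectedFour_isingMeasure_le_of_clusteringMass_le (G := (zdGraph d).comap φ) hβ h1 h2
    Ks r y (p := fun u => p u) (fun u => hp0 u) hp
  -- expectations of measurable observables: the free state of `Λ` is the model on `↥Λ`
  have hE : ∀ {f : SpinConfig (Site d) → ℝ}, Measurable f →
      isingExpect (zdGraph d) Λ β 0 .free f =
        isingExpect ((zdGraph d).comap φ) Finset.univ β 0 .free
          (fun τ => f (SpinConfig.extendAlong φ τ)) := by
    intro f hf
    have h1 := isingExpect_free_map (G := (zdGraph d).comap φ) (G' := zdGraph d) φ
      (Λ := Finset.univ) (fun a _ b _ => Iff.rfl) β 0 hf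
    rw [hmapΛ] at h1
    exact h1
  -- transport the four-point function
  have hn : nPoint (isingMeasure (zdGraph d) Λ β 0 .free) spinAt x =
      nPoint (isingMeasure ((zdGraph d).comap φ) Finset.univ β 0 .free) spinAt y := by
    change isingExpect (zdGraph d) Λ β 0 .free (fun σ => ∏ i, spinAt (x i) σ) =
      isingExpect ((zdGraph d).comap φ) Finset.univ β 0 .free (fun τ => ∏ i, spinAt (y i) τ)
    rw [hE (Finset.measurable_prod _ fun i _ => measurable_spinAt _)]
    congr 1
    funext τ
    refine Finset.prod_congr rfl fun i _ => ?_
    exact spinAt_extendAlong φ τ (y i)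
  -- transport the two-point functions
  have h2p : ∀ a b : ↥Λ, isingTwoPoint (zdGraph d) Λ β 0 .free (a : Site d) b =
      isingTwoPoint ((zdGraph d).comap φ) Finset.univ β 0 .free a b := by
    intro a b
    have := isingTwoPoint_free_map (G := (zdGraph d).comap φ) (G' := zdGraph d) φ
      (Λ := Finset.univ) (fun a _ b _ => Iff.rfl) β 0 a b
    rw [hmapΛ] at this
    exact this
  have hc : connectedFour (isingMeasure (zdGraph d) Λ β 0 .free) spinAt x =
      connectedFour (isingMeasure ((zdGraph d).comap φ) Finset.univ β 0 .free) spinAt y := by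
    simp only [connectedFour, hn]
    have : ∀ i j, twoPoint (isingMeasure (zdGraph d) Λ β 0 .free) spinAt (x i) (x j) =
        twoPoint (isingMeasure ((zdGraph d).comap φ) Finset.univ β 0 .free) spinAt (y i) (y j) :=
      fun i j => h2p (y i) (y j)
    simp only [this]
  rw [hc]
  refine key.trans (le_of_eq ?_)
  congr 1
  rw [← Finset.sum_coe_sort Λ]
  refine Finset.sum_congr rfl fun u _ => ?_
  congr 1
  refine Finset.prod_congr rfl fun j _ => ?_
  exact (h2p u (y j)).symm

/-- **The finite-volume bulk form of the improved tree diagram bound, modulo clustering in the bulk.**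
For the free state of the box `Λ_N ⊆ ℤ^d` (`β ≥ 0`), a scale sequence `1 ≤ ℓ₁`, `2ℓ_k ≤ ℓ_{k+1}`,
and weights `0 ≤ p_u ≤ 1` bounding the normalised clustering masses of the induced graph on `↥Λ_N`,
with `p_u ≤ a` on the bulk `Λ_{N-R}`:
`|U₄^{Λ_N}(x)| ≤ 2(a + 2^{-r}) ∑_{u ∈ Λ_N} ∏ⱼ ⟨σ_uσ_{xⱼ}⟩_{Λ_N} + 4 ∑_{u ∈ Λ_N, ‖u‖_∞ > N-R} ∏ⱼ ⟨σ_uσ_{xⱼ}⟩_{Λ_N}`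
— the hypothesis shape of `abs_connectedFour_le_of_finiteVolume_free` and of
`aizenmanDuminilCopin_improvedTreeDiagramBound_of_finiteVolume` (`ImprovedTreeDiagramBoundTransfer`),
with `A = 2(a + 2^{-r})`, `E = 4`. (Aizenman–Duminil-Copin 2021, §4.1/§6.1, with the
intersection-clustering bound `p_u ≤ 2^{-δK}` granted in the bulk only.) [cite: AizenmanDuminilCopinAnnals2021, arXiv:1912.07973 §4.1, proof of Thm 1.3 (p. 11) and §6.1, Prop. 6.1 (p. 21)] -/
theorem abs_connectedFour_free_box_le_of_bulk_clustering {β : ℝ} (hβ : 0 ≤ β) (N R : ℕ)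
    {ℓ : ℕ → ℕ} (h1 : 1 ≤ ℓ 1) (h2 : ∀ k, 2 * ℓ k ≤ ℓ (k + 1)) (Ks r : ℕ)
    (x : Fin 4 → Site d) (hx : ∀ i, x i ∈ box d N) {a : ℝ} (ha : 0 ≤ a) {p : Site d → ℝ}
    (hp0 : ∀ u, 0 ≤ p u) (hp1 : ∀ u, p u ≤ 1) (hpa : ∀ u ∈ box d (N - R), p u ≤ a)
    (hp : ∀ u : ↥(box d N),
      Current.clusteringMass (G := (zdGraph d).comap (Function.Embedding.subtype fun v => v ∈ box d N))
          (fun _ => β) ℓ Ks r ⟨x 0, hx 0⟩ ⟨x 1, hx 1⟩ ⟨x 2, hx 2⟩ ⟨x 3, hx 3⟩ u ≤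
        ENNReal.ofReal (p u) *
          (ecurrentSum (G := (zdGraph d).comap (Function.Embedding.subtype fun v => v ∈ box d N))
              (fun _ => β) ({⟨x 1, hx 1⟩} ∆ {u}) *
            ecurrentSum (G := (zdGraph d).comap (Function.Embedding.subtype fun v => v ∈ box d N))
              (fun _ => β) ({⟨x 0, hx 0⟩} ∆ {u}) *
            (ecurrentSum (G := (zdGraph d).comap (Function.Embedding.subtype fun v => v ∈ box d N))
                (fun _ => β) ({⟨x 3, hx 3⟩} ∆ {u}) *
              ecurrentSum (G := (zdGraph d).comap (Function.Embedding.subtype fun v => v ∈ box d N))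
                (fun _ => β) ({⟨x 2, hx 2⟩} ∆ {u})))) :
    |connectedFour (isingMeasure (zdGraph d) (box d N) β 0 .free) spinAt x| ≤
      2 * (a + 1 / 2 ^ r) * ∑ u ∈ box d N, ∏ j, isingTwoPoint (zdGraph d) (box d N) β 0 .free u (x j) +
      4 * ∑ u ∈ (box d N).filter (fun u => N - R < Site.supNorm u),
            ∏ j, isingTwoPoint (zdGraph d) (box d N) β 0 .free u (x j) := by
  classical
  have key := abs_connectedFour_free_finset_le_of_clusteringMass_le hβ (box d N) h1 h2 Ks r x hx hp0 hp
  refine key.trans ?_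
  have hgks : ∀ {Λ A : Finset (Site d)} {β h : ℝ} {bc : BoundaryCondition (Site d)},
      gks_one (zdGraph d) (Λ := Λ) (A := A) (β := β) (h := h) (bc := bc) :=
    GKSInequalities.gks_one_holds (zdGraph d)
  set T : Site d → ℝ := fun u => ∏ j, isingTwoPoint (zdGraph d) (box d N) β 0 .free u (x j) with hT
  have hT0 : ∀ u ∈ box d N, 0 ≤ T u := fun u hu =>
    Finset.prod_nonneg fun j _ => isingTwoPoint_free_nonneg hgks hβ hu (hx j)
  have hr0 : (0 : ℝ) ≤ 1 / 2 ^ r := by positivity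
  have hr1 : (1 : ℝ) / 2 ^ r ≤ 1 := by
    rw [div_le_one (by positivity)]
    exact one_le_pow₀ (by norm_num)
  -- split the sum into bulk and boundary layer
  set s := (box d N).filter (fun u => N - R < Site.supNorm u) with hs
  set b := (box d N).filter (fun u => ¬ N - R < Site.supNorm u) with hb
  have hsplit : ∑ u ∈ box d N, T u * (p u + 1 / 2 ^ r) =
      ∑ u ∈ b, T u * (p u + 1 / 2 ^ r) + ∑ u ∈ s, T u * (p u + 1 / 2 ^ r) := by
    rw [hs, hb, add_comm, Finset.sum_filter_add_sum_filter_not]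
  have hbulk : ∑ u ∈ b, T u * (p u + 1 / 2 ^ r) ≤ (a + 1 / 2 ^ r) * ∑ u ∈ box d N, T u := by
    have hbsub : b ⊆ box d N := Finset.filter_subset _ _
    have hbmem : ∀ u ∈ b, u ∈ box d (N - R) := fun u hu => by
      have h := (Finset.mem_filter.1 hu).2
      exact mem_box_iff_supNorm_le.2 (not_lt.1 h)
    calc ∑ u ∈ b, T u * (p u + 1 / 2 ^ r) ≤ ∑ u ∈ b, T u * (a + 1 / 2 ^ r) :=
          Finset.sum_le_sum fun u hu => mul_le_mul_of_nonneg_left (by linarith [hpa u (hbmem u hu)])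
            (hT0 u (hbsub hu))
      _ = (a + 1 / 2 ^ r) * ∑ u ∈ b, T u := by rw [Finset.mul_sum]; exact Finset.sum_congr rfl fun u _ => mul_comm _ _
      _ ≤ (a + 1 / 2 ^ r) * ∑ u ∈ box d N, T u :=
          mul_le_mul_of_nonneg_left
            (Finset.sum_le_sum_of_subset_of_nonneg hbsub fun u hu _ => hT0 u hu) (by positivity)
  have hbdry : ∑ u ∈ s, T u * (p u + 1 / 2 ^ r) ≤ 2 * ∑ u ∈ s, T u := by
    rw [Finset.mul_sum]
    refine Finset.sum_le_sum fun u hu => ?_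
    have hu' : u ∈ box d N := (Finset.mem_filter.1 hu).1
    calc T u * (p u + 1 / 2 ^ r) ≤ T u * 2 :=
          mul_le_mul_of_nonneg_left (by linarith [hp1 u]) (hT0 u hu')
      _ = 2 * T u := mul_comm _ _
  calc 2 * ∑ u ∈ box d N, T u * (p u + 1 / 2 ^ r)
      = 2 * (∑ u ∈ b, T u * (p u + 1 / 2 ^ r) + ∑ u ∈ s, T u * (p u + 1 / 2 ^ r)) := by rw [hsplit]
    _ ≤ 2 * ((a + 1 / 2 ^ r) * ∑ u ∈ box d N, T u + 2 * ∑ u ∈ s, T u) :=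
        mul_le_mul_of_nonneg_left (add_le_add hbulk hbdry) (by norm_num)
    _ = 2 * (a + 1 / 2 ^ r) * ∑ u ∈ box d N, T u + 4 * ∑ u ∈ s, T u := by ring

end Lattice

/-! ### Part 4. The bulk form with the clustering masses bounded on the bulk only -/

section Bulk

namespace Current

variable {G : SimpleGraph V} [DecidableRel G.Adj]

/-- `clusteringMass u ≤ Z[yu]Z[xu] · Z[tu]Z[zu]`: the clustering indicator is at most `1`, so the
normalised clustering probability `P^{uy,ux} ⊗ P^{ut,uz}[M_u < 7r]` is at most `1` (the only bound
available for `u` near the boundary of a finite volume). [folklore] -/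
theorem clusteringMass_le_prod [PseudoMetricSpace V] (K : G.edgeFinset → ℝ) (ℓ : ℕ → ℕ) (Ks r : ℕ)
    (x y z t u : V) :
    clusteringMass K ℓ Ks r x y z t u ≤
      ecurrentSum K ({y} ∆ {u}) * ecurrentSum K ({x} ∆ {u}) *
        (ecurrentSum K ({t} ∆ {u}) * ecurrentSum K ({z} ∆ {u})) := by
  unfold clusteringMass
  calc ∑' pq : (Current G × Current G) × (Current G × Current G),
        epairWeight K ({y} ∆ {u}) ({x} ∆ {u}) pq.1 * epairWeight K ({t} ∆ {u}) ({z} ∆ {u}) pq.2 *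
          (if annulusCount ℓ Ks ((pq.1.1 + pq.1.2).cluster u ∩ (pq.2.1 + pq.2.2).cluster u) u < 7 * r
            then 1 else 0)
      ≤ ∑' pq : (Current G × Current G) × (Current G × Current G),
          epairWeight K ({y} ∆ {u}) ({x} ∆ {u}) pq.1 * epairWeight K ({t} ∆ {u}) ({z} ∆ {u}) pq.2 := by
        refine ENNReal.tsum_le_tsum fun pq => ?_
        split_ifs
        · rw [mul_one]
        · rw [mul_zero]; exact bot_le
    _ = (∑' p : Current G × Current G, epairWeight K ({y} ∆ {u}) ({x} ∆ {u}) p) *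
          ∑' q : Current G × Current G, epairWeight K ({t} ∆ {u}) ({z} ∆ {u}) q :=
        (tsum_mul_tsum_eq_tsum_prod _ _).symm
    _ = _ := by rw [tsum_epairWeight, tsum_epairWeight]

end Current

variable {d : ℕ}

/-- **The finite-volume bulk form of the improved tree diagram bound, from a bound on the bulk
clustering masses alone.** For the free state of `Λ_N ⊆ ℤ^d` (`β ≥ 0`), a scale sequence `1 ≤ ℓ₁`,
`2ℓ_k ≤ ℓ_{k+1}`, and `a ≥ 0` such that the clustering masses of the induced graph on `↥Λ_N` satisfy
`clusteringMass u ≤ a · Z[x₁u]Z[x₀u]Z[x₃u]Z[x₂u]` for every `u` of the bulk `‖u‖_∞ ≤ N - R` (the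
intersection-clustering bound, ADC Prop. 6.1, where it is available), one has
`|U₄^{Λ_N}(x)| ≤ 2(a + 2^{-r}) ∑_{u ∈ Λ_N} ∏ⱼ ⟨σ_uσ_{xⱼ}⟩_{Λ_N} + 4 ∑_{u ∈ Λ_N, ‖u‖_∞ > N-R} ∏ⱼ ⟨σ_uσ_{xⱼ}⟩_{Λ_N}`
(boundary vertices: `clusteringMass_le_prod`). Feeding this, for all large `N`, to
`abs_connectedFour_le_of_finiteVolume_free` / `aizenmanDuminilCopin_improvedTreeDiagramBound_of_finiteVolume`
(`ImprovedTreeDiagramBoundTransfer`) with `A = 2(a + 2^{-r}) ≤ C/B_L^c` yields Theorem 1.3.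
[cite: AizenmanDuminilCopinAnnals2021, arXiv:1912.07973 §4.1, proof of Thm 1.3 (p. 11) and §6.1, Prop. 6.1 (p. 21)] -/
theorem abs_connectedFour_free_box_le_of_bulk_clusteringMass_le {β : ℝ} (hβ : 0 ≤ β) (N R : ℕ)
    {ℓ : ℕ → ℕ} (h1 : 1 ≤ ℓ 1) (h2 : ∀ k, 2 * ℓ k ≤ ℓ (k + 1)) (Ks r : ℕ)
    (x : Fin 4 → Site d) (hx : ∀ i, x i ∈ box d N) {a : ℝ} (ha : 0 ≤ a)
    (hbulk : ∀ u : ↥(box d N), Site.supNorm (u : Site d) ≤ N - R →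
      Current.clusteringMass (G := (zdGraph d).comap (Function.Embedding.subtype fun v => v ∈ box d N))
          (fun _ => β) ℓ Ks r ⟨x 0, hx 0⟩ ⟨x 1, hx 1⟩ ⟨x 2, hx 2⟩ ⟨x 3, hx 3⟩ u ≤
        ENNReal.ofReal a *
          (ecurrentSum (G := (zdGraph d).comap (Function.Embedding.subtype fun v => v ∈ box d N))
              (fun _ => β) ({⟨x 1, hx 1⟩} ∆ {u}) *
            ecurrentSum (G := (zdGraph d).comap (Function.Embedding.subtype fun v => v ∈ box d N))
              (fun _ => β) ({⟨x 0, hx 0⟩} ∆ {u}) *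
            (ecurrentSum (G := (zdGraph d).comap (Function.Embedding.subtype fun v => v ∈ box d N))
                (fun _ => β) ({⟨x 3, hx 3⟩} ∆ {u}) *
              ecurrentSum (G := (zdGraph d).comap (Function.Embedding.subtype fun v => v ∈ box d N))
                (fun _ => β) ({⟨x 2, hx 2⟩} ∆ {u})))) :
    |connectedFour (isingMeasure (zdGraph d) (box d N) β 0 .free) spinAt x| ≤
      2 * (a + 1 / 2 ^ r) * ∑ u ∈ box d N, ∏ j, isingTwoPoint (zdGraph d) (box d N) β 0 .free u (x j) +
      4 * ∑ u ∈ (box d N).filter (fun u => N - R < Site.supNorm u),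
            ∏ j, isingTwoPoint (zdGraph d) (box d N) β 0 .free u (x j) := by
  classical
  -- the weights: `min a 1` on the bulk, `1` on the boundary layer
  set p : Site d → ℝ := fun u => if Site.supNorm u ≤ N - R then min a 1 else 1 with hp
  have hp0 : ∀ u, 0 ≤ p u := fun u => by
    rw [hp]; dsimp only; split_ifs
    · exact le_min ha zero_le_one
    · exact zero_le_one
  have hp1 : ∀ u, p u ≤ 1 := fun u => by
    rw [hp]; dsimp only; split_ifs
    · exact min_le_right _ _
    · exact le_rfl
  have hpa : ∀ u ∈ box d (N - R), p u ≤ a := fun u hu => by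
    rw [hp]; dsimp only
    rw [if_pos (mem_box_iff_supNorm_le.1 hu)]
    exact min_le_left _ _
  refine abs_connectedFour_free_box_le_of_bulk_clustering hβ N R h1 h2 Ks r x hx ha hp0 hp1 hpa ?_
  intro u
  have htriv := Current.clusteringMass_le_prod
    (G := (zdGraph d).comap (Function.Embedding.subtype fun v => v ∈ box d N))
    (fun _ => β) ℓ Ks r ⟨x 0, hx 0⟩ ⟨x 1, hx 1⟩ ⟨x 2, hx 2⟩ ⟨x 3, hx 3⟩ u
  by_cases hu : Site.supNorm (u : Site d) ≤ N - R
  · have hpu : p u = min a 1 := by rw [hp]; dsimp only; rw [if_pos hu]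
    rw [hpu]
    rcases le_total a 1 with ha1 | ha1
    · rw [min_eq_left ha1]
      exact hbulk u hu
    · rw [min_eq_right ha1, ENNReal.ofReal_one, one_mul]
      exact htriv
  · have hpu : p u = 1 := by rw [hp]; dsimp only; rw [if_neg hu]
    rw [hpu, ENNReal.ofReal_one, one_mul]
    exact htriv

end Bulk

end Literature.Probability.LatticeModels
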